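import Summits.BirchSwinnertonDyer.BirchSwinnertonDyer.Theorems.KolyvaginDepthDoorDepthTableCruxClause
import Summits.BirchSwinnertonDyer.BirchSwinnertonDyer.Theorems.KolyvaginDepthDoorDepthTableRows5
import Summits.BirchSwinnertonDyer.BirchSwinnertonDyer.Theorems.Rank1ResidualIntModelSurjectivity
import Summits.BirchSwinnertonDyer.Rank1Residual.Additive.PointCountEulerNat
import HarnessLib

/-!
# Route `KolyvaginDepthDoor` — DEPTH TABLE, the curves ADDITIVE at `2` (`916c1`): `ρ̄_{E,5}` onto by
# Serre's Prop. 19 from three Frobenius traces, so their rows too have EVERY side condition proved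
# (crux `KolyvaginDepthSupply`, stmt-BirchSwinnertonDyer-21765)

Helper file (`--supports stmt-BirchSwinnertonDyer-21765 --as helper`); it closes nothing and BSD is
not proved by it. The row files `KolyvaginDepthDoorDepthTableRows*` prove `ρ̄_{E,p}` onto for the 15 SEMISTABLE
depth-table curves by Serre 1972 Prop. 21 and keep it as a hypothesis `hsurj` for the three curves
additive at `2` (`664a1`, `916c1`, `944e1`). Serre's Prop. 19 (§2.8; any `E/ℚ`) needs no
semistability: three Frobenius elements with i) `a² − 4q` a non-zero square, `a ≢ 0`, ii) `a² − 4q`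
a non-square, `a ≢ 0`, iii) `u = a²/q ∉ {0,1,2,4}`, `u² − 3u + 1 ≢ 0 (mod p)` put `SL₂(𝔽_p)` inside
the image, and `det = χ̄_p` is onto — the TREE theorem
`Rank1Residual.IntModel.hasSurjectiveModNGaloisRep_of_intModel_of_serreWitnesses`
(`Rank1ResidualIntModelSurjectivity`), fed here with kernel point counts. Hence for these curves
too: `hasSurjectiveModNGaloisRep_5` (unconditional), the row `depthRow_5_negD_ℓ'` and the crux
clause `kolyvaginDepthSupply_clause'` with NO surjectivity hypothesis — modulo Kolyvagin 1991 Thm. 4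
(`hF`) and the computed bit `c_1(ℓ) ≠ 0` only, exactly like the 15 semistable rows.

References: [Serre1972] §2.8 Prop. 19, §5.2 (iii); [Serre1981] §8.1 (238); [Kolyvagin1991MathAnn]
§2 Thm. 4; [WZhang2014] Thm. 11.2 (i); [CremonaAlgorithms1997] Table 1.
-/


set_option linter.dupNamespace false

noncomputable section

open scoped Classical NumberField

namespace Summit.BirchSwinnertonDyer.BirchSwinnertonDyer.Theorems.KolyvaginDepthDoor

open Literature.NumberTheory.EllipticCurves Literature.NumberTheory.EllipticCurves.ModularForms
  WeierstrassCurve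
open Summit.BirchSwinnertonDyer.BirchSwinnertonDyer.Rank2Observatory
open Summit.BirchSwinnertonDyer.BirchSwinnertonDyer.Rank1Residual
open Summit.BirchSwinnertonDyer.Rank1Residual.Additive


/-! ## `916c1` (additive at `2`): `ρ̄_{E,5}` onto by Serre's Prop. 19, and the row / crux clause with NO `hsurj` -/

namespace C916c1

/-- `#Ẽ(𝔽_13) = 18`, `a_13 = -4` (Serre Prop. 19 witness at `p = 5`) for `916c1`, kernel-decided (`ℕ`-arithmetic Euler
count `PointCountNat.natCard_point_map_eq`). [cite: CremonaAlgorithms1997, Table 1 (916c1)] -/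
theorem card_13 :
    Nat.card (((⟨0, 0, 0, -4, 1⟩ : WeierstrassCurve ℤ).map (Int.castRingHom (ZMod 13))).toAffine.Point) = 18 := by
  rw [PointCountNat.natCard_point_map_eq (hℓ := ⟨by norm_num⟩) (by norm_num) 0 0 0 (-4) 1
    (by decide +kernel)]
  decide +kernel

/-- **`ρ̄_{E,5}` is surjective for `E = 916c1`** (unconditional; the curve is ADDITIVE at `2`, so Serre's Prop. 21 is
unavailable — Serre's Prop. 19 instead, tree theorem `IntModel.hasSurjectiveModNGaloisRep_of_intModel_of_serreWitnesses`):
Frobenius witnesses i) `q = 13`, `a = -4`: `a² − 4q ≡ 2²` a non-zero square mod `5`, `a ≢ 0`; ii) `q = 3`, `a = -3`: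
`a² − 4q` a non-square, `a ≢ 0`; iii) `q = 3`: `u = a²/q ≡ 3`, `u ∉ {0,1,2,4}`, `u² − 3u + 1 ≢ 0` — all kernel-decided.
[cite: Serre1972, §2.8 Prop. 19 and §5.2 (iii)] -/
theorem hasSurjectiveModNGaloisRep_5 : ((⟨0, 0, 0, -4, 1⟩ : WeierstrassCurve ℤ).map (Int.castRingHom ℚ)).HasSurjectiveModNGaloisRep (5 : ℕ) := by
  have hi : IsSquare (((((13 : ℕ) : ℤ) + 1 - (18 : ℕ) : ℤ) : ZMod 5) ^ 2 - 4 * ((13 : ℕ) : ZMod 5)) ∧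
      ((((13 : ℕ) : ℤ) + 1 - (18 : ℕ) : ℤ) : ZMod 5) ^ 2 - 4 * ((13 : ℕ) : ZMod 5) ≠ 0 ∧ ((((13 : ℕ) : ℤ) + 1 - (18 : ℕ) : ℤ) : ZMod 5) ≠ 0 := by
    decide +kernel
  have hii : ¬ IsSquare (((((3 : ℕ) : ℤ) + 1 - (7 : ℕ) : ℤ) : ZMod 5) ^ 2 - 4 * ((3 : ℕ) : ZMod 5)) ∧ ((((3 : ℕ) : ℤ) + 1 - (7 : ℕ) : ℤ) : ZMod 5) ≠ 0 := by
    decide +kernel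
  have hiii : ∃ u : ZMod 5, ((((3 : ℕ) : ℤ) + 1 - (7 : ℕ) : ℤ) : ZMod 5) ^ 2 = u * ((3 : ℕ) : ZMod 5) ∧
      u ≠ 0 ∧ u ≠ 1 ∧ u ≠ 2 ∧ u ≠ 4 ∧ u ^ 2 - 3 * u + 1 ≠ 0 := ⟨3, by decide +kernel⟩
  haveI := Fact.mk (by norm_num : Nat.Prime 5)
  haveI := Fact.mk (by norm_num : Nat.Prime 13)
  haveI := Fact.mk (by norm_num : Nat.Prime 3)
  haveI := isElliptic_c916c1
  haveI := isGloballyMinimal_c916c1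
  exact IntModel.hasSurjectiveModNGaloisRep_of_intModel_of_serreWitnesses intModel 5 (by norm_num) 13 3 3
    (by norm_num) (by norm_num) (by norm_num) (by decide +kernel) (by decide +kernel) (by decide +kernel)
    (n₁ := 18) (n₂ := 7) (n₃ := 7) card_13 card_3 card_3 hi hii hiii

/-- **DEPTH-TABLE ROW `916c1` with EVERY side condition proved** (the row `depthRow_5_neg111_19` of the row file with its
hypothesis `hsurj` discharged by `hasSurjectiveModNGaloisRep_5`): `c_1(19) ≠ 0 ⇒ t_5 = 0 ∧ rank = 2 ∧ s_5 = 2 ∧ s_5(E^(-111)) = 1`,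
modulo Kolyvagin 1991 Thm. 4 only. BSD is not proved by it. [cite: Kolyvagin1991MathAnn, §2 Thm. 4] -/
theorem depthRow_5_neg111_19' (hF : Kolyvagin1991_selmerCorank_of_kolyvaginClass_ne_zero)
    (K : Type) [Field K] [NumberField K] (hK : IsImaginaryQuadratic K)
    (hD : NumberField.discr K = -111) :
    haveI := isElliptic_c916c1;
    haveI := isGloballyMinimal_c916c1;
    haveI : NeZero (((⟨0, 0, 0, -4, 1⟩ : WeierstrassCurve ℤ).map (Int.castRingHom ℚ)).conductorNorm ℤ) := neZero_conductorNorm_of_isElliptic _;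
    ∀ (Dt : ModularParametrizationData ((⟨0, 0, 0, -4, 1⟩ : WeierstrassCurve ℤ).map (Int.castRingHom ℚ)) (((⟨0, 0, 0, -4, 1⟩ : WeierstrassCurve ℤ).map (Int.castRingHom ℚ)).conductorNorm ℤ)) (β : ℤ)
    (ι : K →+* ℂ) (d : KolyvaginHeegnerData Dt β ι 19),
    d.kolyvaginClass (p := 5) (by norm_num) 1 ≠ 0 →
    ((⟨0, 0, 0, -4, 1⟩ : WeierstrassCurve ℤ).map (Int.castRingHom ℚ)).shaCorank 5 = 0 ∧ ((⟨0, 0, 0, -4, 1⟩ : WeierstrassCurve ℤ).map (Int.castRingHom ℚ)).mordellWeilRank = 2 ∧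
      ((⟨0, 0, 0, -4, 1⟩ : WeierstrassCurve ℤ).map (Int.castRingHom ℚ)).selmerCorank 5 = 2 ∧
      (((⟨0, 0, 0, -4, 1⟩ : WeierstrassCurve ℤ).map (Int.castRingHom ℚ)).quadraticTwist ((-111 : ℤ) : ℚ)).selmerCorank 5 = 1 :=
  depthRow_5_neg111_19 hF hasSurjectiveModNGaloisRep_5 K hK hD

/-- **The crux `KolyvaginDepthSupply` RESTRICTED TO `916c1` is decided by one computation (modulo Kolyvagin 1991
Thm. 4).** For `E = 916c1`, any imaginary quadratic `K` with `d_K = -111`, any `(Dt, β, ι)` and any Kolyvagin–Heegner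
datum `d` of conductor `19`: `c_1(19) ≠ 0` ⇒ the clause of `KolyvaginDepthSupply` at `E`, VERBATIM (witnesses: `p = 5`,
this `K`, the minimal non-zero class of the system). Side conditions all kernel-proved (row file);
conditional on `hF` and the bit; BSD is not proved by it. [cite: Kolyvagin1991MathAnn, §2 Thm. 4] [cite: WZhang2014, Thm. 11.2 (i)] -/
theorem kolyvaginDepthSupply_clause' (hF : Kolyvagin1991_selmerCorank_of_kolyvaginClass_ne_zero)
    (K : Type) [Field K] [NumberField K] (hK : IsImaginaryQuadratic K)
    (hD : NumberField.discr K = -111) :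
    haveI := isElliptic_c916c1;
    haveI := isGloballyMinimal_c916c1;
    haveI : NeZero (((⟨0, 0, 0, -4, 1⟩ : WeierstrassCurve ℤ).map (Int.castRingHom ℚ)).conductorNorm ℤ) := neZero_conductorNorm_of_isElliptic _;
    ∀ (Dt : ModularParametrizationData ((⟨0, 0, 0, -4, 1⟩ : WeierstrassCurve ℤ).map (Int.castRingHom ℚ)) (((⟨0, 0, 0, -4, 1⟩ : WeierstrassCurve ℤ).map (Int.castRingHom ℚ)).conductorNorm ℤ)) (β : ℤ)
    (ι : K →+* ℂ) (d : KolyvaginHeegnerData Dt β ι 19),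
    d.kolyvaginClass (p := 5) (by norm_num) 1 ≠ 0 →
    ∃ (p : ℕ) (hp : Fact p.Prime), 5 ≤ p ∧ ((⟨0, 0, 0, -4, 1⟩ : WeierstrassCurve ℤ).map
      (Int.castRingHom ℚ)).HasGoodReductionAtPrime p ∧ ¬ (p : ℤ) ∣ ((⟨0, 0, 0, -4, 1⟩ :
      WeierstrassCurve ℤ).map (Int.castRingHom ℚ)).frobeniusTrace p ∧ ((⟨0, 0, 0, -4, 1⟩ :
      WeierstrassCurve ℤ).map (Int.castRingHom ℚ)).HasSurjectiveModNGaloisRep p ∧ ∃ (K : Type) (_ :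
      Field K) (_ : NumberField K), Literature.NumberTheory.EllipticCurves.IsImaginaryQuadratic K ∧
      NumberField.discr K ≠ -3 ∧ NumberField.discr K ≠ -4 ∧ ¬ ((p : ℤ) ∣ NumberField.discr K) ∧ ¬ (p
      ∣ ((⟨0, 0, 0, -4, 1⟩ : WeierstrassCurve ℤ).map (Int.castRingHom ℚ)).conductorNorm ℤ) ∧ ∃ (_ :
      NeZero (((⟨0, 0, 0, -4, 1⟩ : WeierstrassCurve ℤ).map (Int.castRingHom ℚ)).conductorNorm ℤ)),
      Literature.NumberTheory.EllipticCurves.SatisfiesHeegnerHypothesis (((⟨0, 0, 0, -4, 1⟩ :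
      WeierstrassCurve ℤ).map (Int.castRingHom ℚ)).conductorNorm ℤ) K ∧ ∃ (Dt :
      Literature.NumberTheory.EllipticCurves.ModularForms.ModularParametrizationData ((⟨0, 0, 0, -4,
      1⟩ : WeierstrassCurve ℤ).map (Int.castRingHom ℚ)) (((⟨0, 0, 0, -4, 1⟩ : WeierstrassCurve
      ℤ).map (Int.castRingHom ℚ)).conductorNorm ℤ)) (β : ℤ) (ι : K →+* ℂ) (n : ℕ) (d :
      Literature.NumberTheory.EllipticCurves.KolyvaginHeegnerData Dt β ι n) (M : ℕ),
      Literature.NumberTheory.EllipticCurves.KolyvaginDescent.KolSupp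
      (Literature.NumberTheory.EllipticCurves.Zhang2014.IsKolyvaginPrime (((⟨0, 0, 0, -4, 1⟩ :
      WeierstrassCurve ℤ).map (Int.castRingHom ℚ)).conductorNorm ℤ) ((⟨0, 0, 0, -4, 1⟩ :
      WeierstrassCurve ℤ).map (Int.castRingHom ℚ)) K p) n ∧ 1 ≤ M ∧ (M : ℕ∞) ≤
      Literature.NumberTheory.EllipticCurves.Zhang2014.levelIndex ((⟨0, 0, 0, -4, 1⟩ :
      WeierstrassCurve ℤ).map (Int.castRingHom ℚ)) p n ∧ d.kolyvaginClass hp.out M ≠ 0 ∧ (∀ (n' : ℕ)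
      (d' : Literature.NumberTheory.EllipticCurves.KolyvaginHeegnerData Dt β ι n') (M' : ℕ),
      Literature.NumberTheory.EllipticCurves.KolyvaginDescent.KolSupp
      (Literature.NumberTheory.EllipticCurves.Zhang2014.IsKolyvaginPrime (((⟨0, 0, 0, -4, 1⟩ :
      WeierstrassCurve ℤ).map (Int.castRingHom ℚ)).conductorNorm ℤ) ((⟨0, 0, 0, -4, 1⟩ :
      WeierstrassCurve ℤ).map (Int.castRingHom ℚ)) K p) n' → 1 ≤ M' → (M' : ℕ∞) ≤
      Literature.NumberTheory.EllipticCurves.Zhang2014.levelIndex ((⟨0, 0, 0, -4, 1⟩ :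
      WeierstrassCurve ℤ).map (Int.castRingHom ℚ)) p n' → d'.kolyvaginClass hp.out M' ≠ 0 →
      n.primeFactors.card ≤ n'.primeFactors.card) ∧ ((n.primeFactors.card + 1 = ((⟨0, 0, 0, -4, 1⟩ :
      WeierstrassCurve ℤ).map (Int.castRingHom ℚ)).mordellWeilRank ∧ (((⟨0, 0, 0, -4, 1⟩ :
      WeierstrassCurve ℤ).map (Int.castRingHom ℚ)).quadraticTwist (NumberField.discr K :
      ℚ)).mordellWeilRank < ((⟨0, 0, 0, -4, 1⟩ : WeierstrassCurve ℤ).map (Int.castRingHom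
      ℚ)).mordellWeilRank) ∨ (n.primeFactors.card = ((⟨0, 0, 0, -4, 1⟩ : WeierstrassCurve ℤ).map
      (Int.castRingHom ℚ)).mordellWeilRank ∧ (((⟨0, 0, 0, -4, 1⟩ : WeierstrassCurve ℤ).map
      (Int.castRingHom ℚ)).quadraticTwist (NumberField.discr K : ℚ)).mordellWeilRank = ((⟨0, 0, 0,
      -4, 1⟩ : WeierstrassCurve ℤ).map (Int.castRingHom ℚ)).mordellWeilRank + 1)) := by
  haveI := isElliptic_c916c1
  haveI := isGloballyMinimal_c916c1
  haveI : NeZero (((⟨0, 0, 0, -4, 1⟩ : WeierstrassCurve ℤ).map (Int.castRingHom ℚ)).conductorNorm ℤ) := neZero_conductorNorm_of_isElliptic _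
  intro Dt β ι d hne
  haveI := Fact.mk (by norm_num : Nat.Prime 5)
  exact kolyvaginDepthSupply_clause_of_intModel_certificate intModel hF KernelCerts002.C916c1.two_le_rank 5
    (by norm_num) (by decide +kernel) (np := 9) card_5 (by decide +kernel) hasSurjectiveModNGaloisRep_5 K hK hD
    (by norm_num) (by norm_num) (by norm_num) heegner_neg111 19 (by norm_num) (by norm_num) (by decide +kernel)
    (by norm_num) (by norm_num) (by norm_num) (by norm_num) (n := 25) card_19 (by norm_num) Dt β ι d hne

end C916c1

end Summit.BirchSwinnertonDyer.BirchSwinnertonDyer.Theorems.KolyvaginDepthDoor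

end
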